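import Summits.QuantumFields.BalabanUV.Beta.GAN24.RespGaugeStencil
import Summits.QuantumFields.BalabanUV.Beta.GAN24.WilsonCurrentSym
import Summits.QuantumFields.BalabanUV.Beta.GAN24.PeriodicCellPairing
import Summits.QuantumFields.BalabanUV.Beta.GAN24.ValueHessianLevelZero

/-!
# `BalabanUV.Beta.GAN24.WilsonFaceCurrentProfile` — binder row G-an2-4 ∕ (CONV-C), W-slot (α-0), typer's PART VI row **T6-VAL**, the (γ) hand's letter **K7-0**:
# **THE LEVEL-`0` TWIN OF K1b ∕ K2 — THE PERIOD-`M` TWO-FACE CURRENTS OF THE WILSON CUBIC TABLE ARE `E2_0`-IMAGES OF K2's OWN BOUNDED `M`-PERIODIC PROFILE**: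
# `Σ'_w χ_M(w_β)·Σ'_t χ_M(t_ν)·wilsonA d ν t z w (inl b)(inl β) = ½·Σ'_s Σ_{b′} E2_0(z,s)_{b b′}·q^{(M)}_{νβ}(b′,s)` and the first-leg form with `−½`, where
# `q^{(M)}_{νβ}(b′,s) = [b′=ν]·M⁻²·σ̃_M(s_β) + [b′=β]·(−M⁻¹σ̃_M(s_ν))·χ_M(s_β)` (`σ̃_M(n) = n mod M − (M−1)∕2`, `χ_M(n) = [n mod M = M−1]`; `ν ≠ β`, every `M ≥ 1`, every `d`) — because
# `curv q^{(M)}_{νβ} = χ_ν⊗χ_β − M⁻²·e_ν∧e_β` and the Wilson Hessian `E2_0 = d*d` (`ValueHessianLevelZero`) kills the constant 2-form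
# (G-an2-4 CRUX TEAM (2), seat `b2b-balaban-gan24-formalise-leaf-06` = the (γ) hand, gen 57; journal [GAN24LEAF06-G57-INTENT-1])

NOT IN PRINT; OUR BOOKKEEPING ([folklore] finite difference algebra + BY NAME: leaf-04's `RespGaugeStencil.tsum_ite_ite_wilsonA_eq_pair ∕ hasSum_pair_faceface_wilsonA` and
`WilsonCurrentSym.tsum_tsum_wilsonA_eq_neg_pair` (nested face sums ↔ pair sums ↔ edge currents), `PeriodicCellPairing.edgeCurrent_eq_neg_half_curvAdj` (edge current =
`−½·curvAdj` of the plaquette column), this seat's `ValueHessianLevelZero.tsum_E2_zero_apply_form(')` (`E2_0 q = d*d q`); 0 `def`, 0 cited fact, 0 `def … : Prop`, 0 sorry).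
HONEST FRAMING (cell contract, verbatim): «discharging `BetaPertH` makes Bałaban's UV stability UNCONDITIONAL — a real constructive-QFT result; it is NOT the continuum
limit and NOT the Clay problem.»  HONEST DEPENDENCY (verbatim): «continuum YM on T⁴ ⇐ BetaPertH ∧ nine spine estimates (0/9 proved); BetaPertH ⇐ (D1) ∧ (D4) ∧ CAP+tail;
G-an2-4 gates asym, D1 and NE2/3/4.»

WHY (memo `HOME/b2b-balaban-gan24-formalise-leaf-06/g55/HX-VALUES-g55.md` §6, K7-0).  At levels `≥ 1` the face-gated slot sums of the value third jet are value-Hessian images of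
the period-`M` staircase, whose bounded periodic pre-image is `q^{(M)}` (K1b `ExitFaceSlotStaircaseDeep`, K2 `StaircaseCurrentPeriodicDeep`).  At LEVEL `0` the table is the Wilson
cubic `wilsonA`, its two-face currents are `∓½·curvAdj` of the plaquette column `F^{(M)}_{νβ} = χ_ν⊗χ_β` (leaf-04), and `F^{(M)}_{νβ} − curv q^{(M)}_{νβ}` is the CONSTANT 2-form
`M⁻²·e_ν∧e_β` (the cell average of the column), which `curvAdj` kills: so the SAME profile serves, with `E2_0 = d*d` in place of `E2_{j+1}` — the input shape of K5 at level `0`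
(`StepCovarianceCellPairingTentZero`), and K3 (`𝒬 q^{(Lc·N)} = Lc^{d+1}·q^{(N)}`) applies unchanged.

WHAT ([folklore]; generic `d`, `M ≥ 1`, `ν ≠ β` where stated):
* §1 one-dimensional bookkeeping: `csaw_succ` (`σ̃_M(n+1) = σ̃_M(n) + 1 − M·χ_M(n)`), `qProfileM_periodic'`, `abs_qProfileM_le_two` (bounded by `2`);
* §2 **`curv_qProfileM`** (`curv q^{(M)}_{νβ} κ l s = ([κ=ν][l=β] − [κ=β][l=ν])·(χ_M(s_ν)χ_M(s_β) − M⁻²)`), **`curvAdj_curv_qProfileM`** (`= curvAdj F^{(M)}_{νβ}`);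
* §3 **`faceface_wilsonA_eq_E2zero`** (second-leg form, `+½`), **`faceface_wilsonA_eq_E2zero_fst`** (first-leg form, `−½`).
Asserts NO value of Bałaban's tables beyond these identities; discharges NOTHING of `hX` ∕ `hXu` ∕ (C)_{≥1} ∕ `hB0` ∕ `hBF` ∕ (Q-L); NEVER «G-an2-4 closed» as (CONV-C); NOT D1, NOT
`BetaPertH`, NOT continuum, NOT Clay.  2026-08-24; no existing file touched.
-/

noncomputable section

open Finset
open scoped BigOperators
open Literature.MathematicalPhysics.QuantumFieldTheory
open Literature.MathematicalPhysics.QuantumFieldTheory.Balaban1983to89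
open Literature.MathematicalPhysics.QuantumFieldTheory.Balaban1983to89.Beta
open ExpKernelCalculus (Site MKer)
open AffineAveraging (Form1 Form2 unitVec curv curvAdj)
open StepJetData (wilsonA)
open BalabanStepJetsSucc (E2)
open Summit.QuantumFields.BalabanUV.Beta.GAN24.RespGaugeStencil (tsum_ite_ite_wilsonA_eq_pair hasSum_pair_faceface_wilsonA)
open Summit.QuantumFields.BalabanUV.Beta.GAN24.WilsonCurrentSym (tsum_tsum_wilsonA_eq_neg_pair)
open Summit.QuantumFields.BalabanUV.Beta.GAN24.PeriodicCellPairing (edgeCurrent_eq_neg_half_curvAdj)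
open Summit.QuantumFields.BalabanUV.Beta.GAN24.ValueHessianLevelZero (tsum_E2_zero_apply_form tsum_E2_zero_apply_form')

namespace Summit.QuantumFields.BalabanUV.Beta.GAN24.WilsonFaceCurrentProfile

variable {d : ℕ}

/-! ## §1 One-dimensional bookkeeping: the centred sawtooth and the exit indicator at period `M` -/

/-- [folklore] **THE FORWARD DIFFERENCE OF THE CENTRED SAWTOOTH**: `σ̃_M(n+1) = σ̃_M(n) + 1 − M·χ_M(n)` (`M ≥ 1`), `σ̃_M(n) = n mod M − (M−1)∕2`, `χ_M(n) = [n mod M = M−1]`. -/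
theorem csaw_succ {M : ℕ} (hM : 1 ≤ M) (n : ℤ) :
    ((((n + 1) % (M : ℤ) : ℤ) : ℝ) - ((M : ℝ) - 1) / 2) =
      ((((n % (M : ℤ) : ℤ) : ℝ) - ((M : ℝ) - 1) / 2)) + 1 - (M : ℝ) * (if n % (M : ℤ) = (M : ℤ) - 1 then (1 : ℝ) else 0) := by
  have hP : (0 : ℤ) < (M : ℤ) := by exact_mod_cast hM
  have h0 : 0 ≤ n % (M : ℤ) := Int.emod_nonneg _ hP.ne'
  have h1 : n % (M : ℤ) < (M : ℤ) := Int.emod_lt_of_pos _ hP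
  rw [← Int.emod_add_emod n (M : ℤ) 1]
  by_cases h : n % (M : ℤ) = (M : ℤ) - 1
  · rw [if_pos h, h, sub_add_cancel, Int.emod_self]
    push_cast
    ring
  · rw [if_neg h, Int.emod_eq_of_lt (by omega) (by omega)]
    push_cast
    ring

/-- [folklore] **K2's PROFILE IS `M`-PERIODIC** (stated right to left): `q^{(M)}_{νβ}(b′, s) = q^{(M)}_{νβ}(b′, s + M•t)`. -/
theorem qProfileM_periodic' (M : ℕ) (ν β b' : Fin (d + 1)) (s t : Site (d + 1)) :
    ((if b' = ν then ((M : ℝ)⁻¹ * (M : ℝ)⁻¹) * ((((s β % (M : ℤ) : ℤ) : ℝ) - ((M : ℝ) - 1) / 2)) else 0)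
        + (if b' = β then (-(M : ℝ)⁻¹ * ((((s ν % (M : ℤ) : ℤ) : ℝ) - ((M : ℝ) - 1) / 2))) * (if s β % (M : ℤ) = (M : ℤ) - 1 then (1 : ℝ) else 0) else 0)) =
      ((if b' = ν then ((M : ℝ)⁻¹ * (M : ℝ)⁻¹) * (((((s + (M : ℤ) • t) β % (M : ℤ) : ℤ) : ℝ) - ((M : ℝ) - 1) / 2)) else 0)
        + (if b' = β then (-(M : ℝ)⁻¹ * (((((s + (M : ℤ) • t) ν % (M : ℤ) : ℤ) : ℝ) - ((M : ℝ) - 1) / 2))) *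
            (if (s + (M : ℤ) • t) β % (M : ℤ) = (M : ℤ) - 1 then (1 : ℝ) else 0) else 0)) := by
  simp only [Pi.add_apply, Pi.smul_apply, smul_eq_mul, Int.add_mul_emod_self_left]

/-- [folklore] The centred sawtooth is bounded by the period: `|n mod M − (M−1)∕2| ≤ M` (`M ≥ 1`). -/
theorem abs_csaw_le {M : ℕ} (hM : 1 ≤ M) (n : ℤ) : |(((n % (M : ℤ) : ℤ) : ℝ) - ((M : ℝ) - 1) / 2)| ≤ (M : ℝ) := by
  have hP : (0 : ℤ) < (M : ℤ) := by exact_mod_cast hM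
  have h0 : (0 : ℝ) ≤ (((n % (M : ℤ) : ℤ) : ℝ)) := by exact_mod_cast Int.emod_nonneg _ hP.ne'
  have h1 : (((n % (M : ℤ) : ℤ) : ℝ)) ≤ (M : ℝ) - 1 := by
    have h := Int.emod_lt_of_pos n hP
    have h' : n % (M : ℤ) ≤ (M : ℤ) - 1 := by omega
    exact_mod_cast h'
  have hM1 : (1 : ℝ) ≤ (M : ℝ) := by exact_mod_cast hM
  rw [abs_le]
  constructor <;> linarith

/-- [folklore] **K2's PROFILE IS BOUNDED BY `2`** (`M ≥ 1`). -/
theorem abs_qProfileM_le_two {M : ℕ} (hM : 1 ≤ M) (ν β b' : Fin (d + 1)) (s : Site (d + 1)) :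
    |((if b' = ν then ((M : ℝ)⁻¹ * (M : ℝ)⁻¹) * ((((s β % (M : ℤ) : ℤ) : ℝ) - ((M : ℝ) - 1) / 2)) else 0)
        + (if b' = β then (-(M : ℝ)⁻¹ * ((((s ν % (M : ℤ) : ℤ) : ℝ) - ((M : ℝ) - 1) / 2))) * (if s β % (M : ℤ) = (M : ℤ) - 1 then (1 : ℝ) else 0) else 0))| ≤ 2 := by
  have hM0 : (0 : ℝ) < (M : ℝ) := by exact_mod_cast hM
  have hM1 : (1 : ℝ) ≤ (M : ℝ) := by exact_mod_cast hM
  have hMinv : (M : ℝ)⁻¹ ≤ 1 := inv_le_one_of_one_le₀ hM1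
  have hMinv0 : 0 ≤ (M : ℝ)⁻¹ := inv_nonneg.mpr hM0.le
  have hA : |(if b' = ν then ((M : ℝ)⁻¹ * (M : ℝ)⁻¹) * ((((s β % (M : ℤ) : ℤ) : ℝ) - ((M : ℝ) - 1) / 2)) else 0)| ≤ 1 := by
    split_ifs
    · rw [abs_mul, abs_of_nonneg (mul_nonneg hMinv0 hMinv0)]
      calc (M : ℝ)⁻¹ * (M : ℝ)⁻¹ * |(((s β % (M : ℤ) : ℤ) : ℝ) - ((M : ℝ) - 1) / 2)|
          ≤ (M : ℝ)⁻¹ * (M : ℝ)⁻¹ * (M : ℝ) := mul_le_mul_of_nonneg_left (abs_csaw_le hM _) (mul_nonneg hMinv0 hMinv0)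
        _ = (M : ℝ)⁻¹ := by field_simp
        _ ≤ 1 := hMinv
    · rw [abs_zero]; exact zero_le_one
  have hB : |(if b' = β then (-(M : ℝ)⁻¹ * ((((s ν % (M : ℤ) : ℤ) : ℝ) - ((M : ℝ) - 1) / 2))) * (if s β % (M : ℤ) = (M : ℤ) - 1 then (1 : ℝ) else 0) else 0)| ≤ 1 := by
    split_ifs
    · rw [mul_one, abs_mul, abs_neg, abs_of_nonneg hMinv0]
      calc (M : ℝ)⁻¹ * |(((s ν % (M : ℤ) : ℤ) : ℝ) - ((M : ℝ) - 1) / 2)| ≤ (M : ℝ)⁻¹ * (M : ℝ) := mul_le_mul_of_nonneg_left (abs_csaw_le hM _) hMinv0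
        _ = 1 := inv_mul_cancel₀ hM0.ne'
    · rw [mul_zero, abs_zero]; exact zero_le_one
    · rw [abs_zero]; exact zero_le_one
  calc _ ≤ _ := abs_add_le _ _
    _ ≤ 1 + 1 := add_le_add hA hB
    _ = 2 := by norm_num

/-! ## §2 The curvature of K2's profile is the plaquette column of indicators minus its cell average -/

/-- [folklore] Coordinates of a unit step: `(s + e_κ) μ = s μ + [κ = μ]`. -/
theorem add_unitVec_apply (s : Site (d + 1)) (κ μ : Fin (d + 1)) :
    (s + unitVec κ) μ = s μ + (if κ = μ then 1 else 0) := by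
  simp only [Pi.add_apply, AffineAveraging.unitVec, Pi.single_apply]
  by_cases h : κ = μ
  · subst h; simp
  · simp [h, Ne.symm h]

/-- NOT IN PRINT; OUR BOOKKEEPING.  **`curv q^{(M)}_{νβ} = χ_ν⊗χ_β − M⁻²·e_ν∧e_β`** (`ν ≠ β`, `M ≥ 1`): for every pattern `(κ, l)` and site `s`,
`curv q^{(M)}_{νβ} κ l s = ([κ=ν][l=β] − [κ=β][l=ν])·(χ_M(s_ν)χ_M(s_β) − M⁻²)` — the forward difference of the centred sawtooth is `1 − M·χ_M`. -/
theorem curv_qProfileM {M : ℕ} (hM : 1 ≤ M) {ν β : Fin (d + 1)} (hνβ : ν ≠ β) (κ l : Fin (d + 1)) (s : Site (d + 1)) :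
    curv (fun (b' : Fin (d + 1)) (s : Site (d + 1)) =>
        ((if b' = ν then ((M : ℝ)⁻¹ * (M : ℝ)⁻¹) * ((((s β % (M : ℤ) : ℤ) : ℝ) - ((M : ℝ) - 1) / 2)) else 0)
          + (if b' = β then (-(M : ℝ)⁻¹ * ((((s ν % (M : ℤ) : ℤ) : ℝ) - ((M : ℝ) - 1) / 2))) * (if s β % (M : ℤ) = (M : ℤ) - 1 then (1 : ℝ) else 0) else 0))) κ l s =
      ((if κ = ν ∧ l = β then (1 : ℝ) else 0) - (if κ = β ∧ l = ν then (1 : ℝ) else 0)) *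
        ((if s ν % (M : ℤ) = (M : ℤ) - 1 then (1 : ℝ) else 0) * (if s β % (M : ℤ) = (M : ℤ) - 1 then (1 : ℝ) else 0) - (M : ℝ)⁻¹ * (M : ℝ)⁻¹) := by
  have hM0 : (M : ℝ) ≠ 0 := by exact_mod_cast (Nat.one_le_iff_ne_zero.mp hM)
  have hβν : β ≠ ν := fun h => hνβ h.symm
  simp only [AffineAveraging.curv, add_unitVec_apply]
  rcases eq_or_ne κ ν with hκν | hκν
  · have hκβ : κ ≠ β := fun h => hνβ (hκν.symm.trans h)
    rcases eq_or_ne l β with hlβ | hlβ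
    · -- the `(ν, β)` component
      have hlν : l ≠ ν := fun h => hβν (hlβ.symm.trans h)
      simp only [hκν, hlβ, hνβ, hβν, if_true, if_false, and_self, add_zero, csaw_succ hM]
      field_simp
      ring
    · rcases eq_or_ne l ν with hlν | hlν
      · -- the `(ν, ν)` component vanishes
        simp only [hκν, hlν, hνβ, if_true, if_false, and_false, false_and, sub_self, zero_mul, add_zero]
        ring
      · -- `(ν, l)` with `l ∉ {ν, β}`
        simp only [hκν, hlν, hlβ, hνβ, if_true, if_false, and_false, sub_self, zero_mul, add_zero]
  · rcases eq_or_ne κ β with hκβ | hκβ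
    · rcases eq_or_ne l ν with hlν | hlν
      · -- the `(β, ν)` component
        have hlβ : l ≠ β := fun h => hνβ (hlν.symm.trans h)
        simp only [hκβ, hlν, hνβ, hβν, if_true, if_false, and_self, add_zero, csaw_succ hM]
        field_simp
        ring
      · rcases eq_or_ne l β with hlβ | hlβ
        · -- `(β, β)` vanishes
          simp only [hκβ, hlβ, hβν, if_true, if_false, and_false, false_and, sub_self, zero_mul]
          ring
        · -- `(β, l)` with `l ∉ {ν, β}`
          simp only [hκβ, hlν, hlβ, hβν, if_true, if_false, and_false, sub_self, zero_mul, add_zero, zero_add]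
    · -- `κ ∉ {ν, β}`
      rcases eq_or_ne l ν with hlν | hlν
      · simp only [hκν, hκβ, hlν, hνβ, if_true, if_false, and_false, false_and, sub_self, zero_mul, add_zero, zero_add]
        ring
      · rcases eq_or_ne l β with hlβ | hlβ
        · simp only [hκν, hκβ, hlβ, hβν, if_true, if_false, and_false, false_and, sub_self, zero_mul, add_zero, zero_add]
          ring
        · simp only [hκν, hκβ, hlν, hlβ, if_false, and_false, sub_self, zero_mul, add_zero]

/-- NOT IN PRINT; OUR BOOKKEEPING.  **HENCE `d*d q^{(M)}_{νβ} = curvAdj F^{(M)}_{νβ}`** with the plaquette column of indicators `F^{(M)}_{νβ} κ l x = [κ=ν∧l=β]χ_M(x_ν)χ_M(x_β) −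
[κ=β∧l=ν]χ_M(x_ν)χ_M(x_β)` (leaf-04's `PeriodicCellPairing` ∕ `WilsonFaceHalfVertex` column with `p = q = χ_M`): the constant 2-form `M⁻²·e_ν∧e_β` is killed by `curvAdj`. -/
theorem curvAdj_curv_qProfileM {M : ℕ} (hM : 1 ≤ M) {ν β : Fin (d + 1)} (hνβ : ν ≠ β) (b : Fin (d + 1)) (z : Site (d + 1)) :
    curvAdj (curv (fun (b' : Fin (d + 1)) (s : Site (d + 1)) =>
        ((if b' = ν then ((M : ℝ)⁻¹ * (M : ℝ)⁻¹) * ((((s β % (M : ℤ) : ℤ) : ℝ) - ((M : ℝ) - 1) / 2)) else 0)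
          + (if b' = β then (-(M : ℝ)⁻¹ * ((((s ν % (M : ℤ) : ℤ) : ℝ) - ((M : ℝ) - 1) / 2))) * (if s β % (M : ℤ) = (M : ℤ) - 1 then (1 : ℝ) else 0) else 0)))) b z =
      curvAdj (fun κ l (x : Site (d + 1)) =>
        (if κ = ν ∧ l = β then (if x ν % (M : ℤ) = (M : ℤ) - 1 then (1 : ℝ) else 0) * (if x β % (M : ℤ) = (M : ℤ) - 1 then (1 : ℝ) else 0) else 0) -
          (if κ = β ∧ l = ν then (if x ν % (M : ℤ) = (M : ℤ) - 1 then (1 : ℝ) else 0) * (if x β % (M : ℤ) = (M : ℤ) - 1 then (1 : ℝ) else 0) else 0)) b z := by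
  have hc : ∀ (κ l : Fin (d + 1)) (x : Site (d + 1)),
      curv (fun (b' : Fin (d + 1)) (s : Site (d + 1)) =>
        ((if b' = ν then ((M : ℝ)⁻¹ * (M : ℝ)⁻¹) * ((((s β % (M : ℤ) : ℤ) : ℝ) - ((M : ℝ) - 1) / 2)) else 0)
          + (if b' = β then (-(M : ℝ)⁻¹ * ((((s ν % (M : ℤ) : ℤ) : ℝ) - ((M : ℝ) - 1) / 2))) * (if s β % (M : ℤ) = (M : ℤ) - 1 then (1 : ℝ) else 0) else 0))) κ l x =
      ((if κ = ν ∧ l = β then (if x ν % (M : ℤ) = (M : ℤ) - 1 then (1 : ℝ) else 0) * (if x β % (M : ℤ) = (M : ℤ) - 1 then (1 : ℝ) else 0) else 0) -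
          (if κ = β ∧ l = ν then (if x ν % (M : ℤ) = (M : ℤ) - 1 then (1 : ℝ) else 0) * (if x β % (M : ℤ) = (M : ℤ) - 1 then (1 : ℝ) else 0) else 0)) -
        ((if κ = ν ∧ l = β then (1 : ℝ) else 0) - (if κ = β ∧ l = ν then (1 : ℝ) else 0)) * ((M : ℝ)⁻¹ * (M : ℝ)⁻¹) := by
    intro κ l x
    rw [curv_qProfileM hM hνβ κ l x]
    split_ifs <;> ring
  simp only [AffineAveraging.curvAdj, hc]
  have hz : ∀ (e : Site (d + 1)) (P : Fin (d + 1) → Fin (d + 1) → ℝ) (G : Form2 (d + 1) ℝ) (κ l : Fin (d + 1)),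
      (G κ l z - P κ l * ((M : ℝ)⁻¹ * (M : ℝ)⁻¹)) - (G κ l (z - e) - P κ l * ((M : ℝ)⁻¹ * (M : ℝ)⁻¹)) = G κ l z - G κ l (z - e) := by
    intros; ring
  have hz' : ∀ (e : Site (d + 1)) (P : Fin (d + 1) → Fin (d + 1) → ℝ) (G : Form2 (d + 1) ℝ) (κ l : Fin (d + 1)),
      (G κ l (z - e) - P κ l * ((M : ℝ)⁻¹ * (M : ℝ)⁻¹)) - (G κ l z - P κ l * ((M : ℝ)⁻¹ * (M : ℝ)⁻¹)) = G κ l (z - e) - G κ l z := by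
    intros; ring
  congr 1
  · refine Finset.sum_congr rfl fun l _ => ?_
    exact hz (unitVec l) (fun κ l => (if κ = ν ∧ l = β then (1 : ℝ) else 0) - (if κ = β ∧ l = ν then (1 : ℝ) else 0))
      (fun κ l (x : Site (d + 1)) => (if κ = ν ∧ l = β then (if x ν % (M : ℤ) = (M : ℤ) - 1 then (1 : ℝ) else 0) * (if x β % (M : ℤ) = (M : ℤ) - 1 then (1 : ℝ) else 0) else 0) -
        (if κ = β ∧ l = ν then (if x ν % (M : ℤ) = (M : ℤ) - 1 then (1 : ℝ) else 0) * (if x β % (M : ℤ) = (M : ℤ) - 1 then (1 : ℝ) else 0) else 0)) b l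
  · refine Finset.sum_congr rfl fun κ _ => ?_
    exact hz' (unitVec κ) (fun κ l => (if κ = ν ∧ l = β then (1 : ℝ) else 0) - (if κ = β ∧ l = ν then (1 : ℝ) else 0))
      (fun κ l (x : Site (d + 1)) => (if κ = ν ∧ l = β then (if x ν % (M : ℤ) = (M : ℤ) - 1 then (1 : ℝ) else 0) * (if x β % (M : ℤ) = (M : ℤ) - 1 then (1 : ℝ) else 0) else 0) -
        (if κ = β ∧ l = ν then (if x ν % (M : ℤ) = (M : ℤ) - 1 then (1 : ℝ) else 0) * (if x β % (M : ℤ) = (M : ℤ) - 1 then (1 : ℝ) else 0) else 0)) κ b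

/-! ## §3 The two-face currents of the Wilson cubic table are `E2_0`-images of K2's profile -/

/-- NOT IN PRINT; OUR BOOKKEEPING.  **SECOND-LEG FORM** (`ν ≠ β`, `M ≥ 1`, every free leg `(z, b)`, every `Lc ≥ 1`): the face-gated slot sum of the Wilson cubic table with the
SECOND leg face-weighted is `+½` the Wilson-Hessian image of K2's profile,
`Σ'_w χ_M(w_β)·Σ'_t [t_ν face]·wilsonA d ν t z w (inl b)(inl β) = ½·Σ'_s Σ_{b′} E2 d Lc 0 z s (inl b)(inl b′)·q^{(M)}_{νβ}(b′, s)`. -/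
theorem faceface_wilsonA_eq_E2zero (Lc : ℕ) [NeZero Lc] {M : ℕ} (hM : 1 ≤ M) {ν β : Fin (d + 1)} (hνβ : ν ≠ β) (z : Site (d + 1)) (b : Fin (d + 1)) :
    (∑' w : Site (d + 1), (if w β % (M : ℤ) = (M : ℤ) - 1 then (1 : ℝ) else 0) *
        ∑' t : Site (d + 1), (if t ν % (M : ℤ) = (M : ℤ) - 1 then wilsonA d ν t z w (Sum.inl b) (Sum.inl β) else 0)) =
      (1 / 2 : ℝ) * ∑' s : Site (d + 1), ∑ b' : Fin (d + 1), E2 d Lc 0 z s (Sum.inl b) (Sum.inl b') *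
        ((if b' = ν then ((M : ℝ)⁻¹ * (M : ℝ)⁻¹) * ((((s β % (M : ℤ) : ℤ) : ℝ) - ((M : ℝ) - 1) / 2)) else 0)
          + (if b' = β then (-(M : ℝ)⁻¹ * ((((s ν % (M : ℤ) : ℤ) : ℝ) - ((M : ℝ) - 1) / 2))) * (if s β % (M : ℤ) = (M : ℤ) - 1 then (1 : ℝ) else 0) else 0)) := by
  -- nested `ite` form ↦ the pair sum (leaf-04)
  have h1 : (∑' w : Site (d + 1), (if w β % (M : ℤ) = (M : ℤ) - 1 then (1 : ℝ) else 0) *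
        ∑' t : Site (d + 1), (if t ν % (M : ℤ) = (M : ℤ) - 1 then wilsonA d ν t z w (Sum.inl b) (Sum.inl β) else 0)) =
      ∑' w : Site (d + 1), (if w β % (M : ℤ) = (M : ℤ) - 1 then
        ∑' t : Site (d + 1), (if t ν % (M : ℤ) = (M : ℤ) - 1 then wilsonA d ν t z w (Sum.inl b) (Sum.inl β) else 0) else 0) := by
    refine tsum_congr fun w => ?_
    split_ifs <;> simp
  rw [h1, tsum_ite_ite_wilsonA_eq_pair M ν β b z,
    (hasSum_pair_faceface_wilsonA (d := d) hνβ (fun n : ℤ => if n % (M : ℤ) = (M : ℤ) - 1 then (1 : ℝ) else 0)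
      (fun n : ℤ => if n % (M : ℤ) = (M : ℤ) - 1 then (1 : ℝ) else 0) b z).tsum_eq,
    edgeCurrent_eq_neg_half_curvAdj hνβ (fun n : ℤ => if n % (M : ℤ) = (M : ℤ) - 1 then (1 : ℝ) else 0)
      (fun n : ℤ => if n % (M : ℤ) = (M : ℤ) - 1 then (1 : ℝ) else 0) b z,
    tsum_E2_zero_apply_form Lc _ z b, curvAdj_curv_qProfileM hM hνβ b z]
  ring

/-- NOT IN PRINT; OUR BOOKKEEPING.  **FIRST-LEG FORM** (`μ ≠ α`, `M ≥ 1`, every free leg `(x, a)`): with the FIRST leg face-weighted the sign flips (the table is antisymmetric under the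
exchange of its legs) and the kernel is read transposed:
`Σ'_y χ_M(y_α)·Σ'_t [t_μ face]·wilsonA d μ t y x (inl α)(inl a) = −½·Σ'_s Σ_{b′} E2 d Lc 0 s x (inl b′)(inl a)·q^{(M)}_{μα}(b′, s)`. -/
theorem faceface_wilsonA_eq_E2zero_fst (Lc : ℕ) [NeZero Lc] {M : ℕ} (hM : 1 ≤ M) {μ α : Fin (d + 1)} (hμα : μ ≠ α) (x : Site (d + 1)) (a : Fin (d + 1)) :
    (∑' y : Site (d + 1), (if y α % (M : ℤ) = (M : ℤ) - 1 then (1 : ℝ) else 0) *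
        ∑' t : Site (d + 1), (if t μ % (M : ℤ) = (M : ℤ) - 1 then wilsonA d μ t y x (Sum.inl α) (Sum.inl a) else 0)) =
      (-(1 / 2 : ℝ)) * ∑' s : Site (d + 1), ∑ b' : Fin (d + 1), E2 d Lc 0 s x (Sum.inl b') (Sum.inl a) *
        ((if b' = μ then ((M : ℝ)⁻¹ * (M : ℝ)⁻¹) * ((((s α % (M : ℤ) : ℤ) : ℝ) - ((M : ℝ) - 1) / 2)) else 0)
          + (if b' = α then (-(M : ℝ)⁻¹ * ((((s μ % (M : ℤ) : ℤ) : ℝ) - ((M : ℝ) - 1) / 2))) * (if s α % (M : ℤ) = (M : ℤ) - 1 then (1 : ℝ) else 0) else 0)) := by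
  have h1 : (∑' y : Site (d + 1), (if y α % (M : ℤ) = (M : ℤ) - 1 then (1 : ℝ) else 0) *
        ∑' t : Site (d + 1), (if t μ % (M : ℤ) = (M : ℤ) - 1 then wilsonA d μ t y x (Sum.inl α) (Sum.inl a) else 0)) =
      ∑' y : Site (d + 1), (if y α % (M : ℤ) = (M : ℤ) - 1 then (1 : ℝ) else 0) *
        ∑' t : Site (d + 1), (if t μ % (M : ℤ) = (M : ℤ) - 1 then (1 : ℝ) else 0) * wilsonA d μ t y x (Sum.inl α) (Sum.inl a) := by
    refine tsum_congr fun y => ?_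
    congr 1
    refine tsum_congr fun t => ?_
    split_ifs <;> simp
  rw [h1, tsum_tsum_wilsonA_eq_neg_pair μ α a (fun n : ℤ => if n % (M : ℤ) = (M : ℤ) - 1 then (1 : ℝ) else 0)
      (fun n : ℤ => if n % (M : ℤ) = (M : ℤ) - 1 then (1 : ℝ) else 0) x,
    (hasSum_pair_faceface_wilsonA (d := d) hμα (fun n : ℤ => if n % (M : ℤ) = (M : ℤ) - 1 then (1 : ℝ) else 0)
      (fun n : ℤ => if n % (M : ℤ) = (M : ℤ) - 1 then (1 : ℝ) else 0) a x).tsum_eq,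
    edgeCurrent_eq_neg_half_curvAdj hμα (fun n : ℤ => if n % (M : ℤ) = (M : ℤ) - 1 then (1 : ℝ) else 0)
      (fun n : ℤ => if n % (M : ℤ) = (M : ℤ) - 1 then (1 : ℝ) else 0) a x,
    tsum_E2_zero_apply_form' Lc _ x a, curvAdj_curv_qProfileM hM hμα a x]
  ring

end Summit.QuantumFields.BalabanUV.Beta.GAN24.WilsonFaceCurrentProfile

end
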